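import Mathlib
import Literature.MathematicalPhysics.QuantumFieldTheory.YangMillsOS
import Literature.MathematicalPhysics.QuantumFieldTheory.QCDTorusTranslation
import Summits.QuantumFields.YangMills.Theorems.FradkinShenkerFlowClusteringToYangMillsStubReconstructibleGeometry
import HarnessLib

/-!
# Stub `stub_rpShift` of crux `ContinuumLegGivenGap` (stmt-QuantumFields-15828), line `Sketch` (reshape 17-RP)

Pure invariance algebra of the torus Wilson state: the connected Euclidean-time correlation
`latticeConnectedCorr r.ρ β (2S+1) (F ∘ Θ) G' n` of a reflected pair is the value of the bond
(`n = a + b`) resp. site (`n = a + b + 1`) reflection form of the odd torus on the CENTRED, SHIFTED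
observables `F° ∘ τᵃ`, `G'° ∘ τᵇ`:

* `corr(F∘Θ, G'; a+b)   = ∫ (F(τᵃ Θ Ũ) − ⟨F⟩)(G'(τᵇ Ũ) − ⟨G'⟩) dμ`,
* `corr(F∘Θ, G'; a+b+1) = ∫ (F(τᵃ Θ Ũ) − ⟨F⟩)(G'(τᵇ τ Ũ) − ⟨G'⟩) dμ`,

where `Ũ = torusLift (2S+1) U`, `Θ = gaugeTimeReflect`, `τᶜ = configShift (−c e₀)` (so that
`τ = gaugeTimeShift = τ¹`), `⟨F⟩ = ∫ F(Ũ) dμ` and `μ = wilsonMeasure r.ρ β`.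

Ingredients (all landed): `τᶜ ∘ Θ = Θ ∘ τ^{−c}` on `ℤ⁴` gauge fields (pointwise, from
`gaugeTimeReflect_apply`), the lift intertwiners `configShift_torusLift` (translations) and
`Reconstructible.gaugeTimeReflect_torusLift` (reflections), translation invariance
`wilsonExpectation_comp_torusConfigShift` and `Θ_T`-invariance
`Reconstructible.wilsonExpectation_comp_timeReflect` of the torus Wilson state; the rest is the
expansion of a centred product under a probability measure.

References: K. Osterwalder, E. Seiler, Ann. Phys. 110 (1978) 440, §2 (folklore manipulations). No
definitions, no notation.
-/

noncomputable section

namespace Summit.QuantumFields.YangMills.Theorems.ContinuumLegGivenGap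

open Filter Topology MeasureTheory
open Literature.MathematicalPhysics.QuantumFieldTheory Literature.MathematicalPhysics.QuantumLattice
  Literature.MathematicalPhysics.AQFT Literature.Probability.LatticeModels
open Summit.QuantumFields.YangMills.Theorems.ClusteringToYangMills

/-! ### Geometry: time shifts against the bond reflection on `ℤ⁴` -/

section Geometry

variable {G : Type}

/-- `θ (x + c e₀) = θ x − c e₀` for the site reflection `θ : x₀ ↦ −1 − x₀`. [folklore] -/
theorem rpShift_latticeTimeReflection_add_single
    (x : Literature.Probability.LatticeModels.Site 4) (c : ℤ) :
    latticeTimeReflection 4 (x + Pi.single 0 c) = latticeTimeReflection 4 x - Pi.single 0 c := by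
  ext j
  by_cases hj : j = 0
  · subst hj; simp; ring
  · simp [hj]

/-- **`τᶜ ∘ Θ = Θ ∘ τ^{−c}`**: `configShift (−c e₀) (Θ U) = Θ (configShift (c e₀) U)`. [folklore] -/
theorem rpShift_configShift_gaugeTimeReflect [Group G] [MeasurableSpace G] (c : ℤ) (U : LGConfig 4 G) :
    configShift (-(Pi.single 0 c)) (gaugeTimeReflect U) =
      gaugeTimeReflect (configShift (Pi.single 0 c) U) := by
  funext e
  rcases e with ⟨x, i⟩
  by_cases hi : i = 0
  · subst hi
    simp only [Literature.MathematicalPhysics.QuantumLattice.configShift_apply, gaugeTimeReflect_apply,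
      ↓reduceIte, sub_neg_eq_add]
    rw [add_right_comm, rpShift_latticeTimeReflection_add_single]
  · simp only [Literature.MathematicalPhysics.QuantumLattice.configShift_apply, gaugeTimeReflect_apply,
      if_neg hi, sub_neg_eq_add]
    rw [rpShift_latticeTimeReflection_add_single]

/-- The trivial translation of `ℤ⁴` gauge fields. [folklore] -/
theorem rpShift_configShift_zero [MeasurableSpace G] (U : LGConfig 4 G) :
    configShift (0 : Literature.Probability.LatticeModels.Site 4) U = U := by
  funext e
  simp [Literature.MathematicalPhysics.QuantumLattice.configShift_apply]

/-- `τ^{−a}` undoes `τᵃ`: `configShift (a e₀) (configShift (−a e₀) U) = U`. [folklore] -/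
theorem rpShift_configShift_neg_cancel [MeasurableSpace G] (a : ℤ) (U : LGConfig 4 G) :
    configShift (Pi.single 0 a) (configShift (-(Pi.single 0 a)) U) = U := by
  rw [← configShift_add', add_neg_cancel, rpShift_configShift_zero]

/-- Composition of time shifts: `τᶜ (τᵃ U) = τ^{a+c} U`. [folklore] -/
theorem rpShift_configShift_configShift [MeasurableSpace G] (a c : ℤ) (U : LGConfig 4 G) :
    configShift (-(Pi.single 0 c)) (configShift (-(Pi.single 0 a)) U) =
      configShift (-(Pi.single 0 (a + c))) U := by
  rw [← configShift_add', ← neg_add, ← Pi.single_add, add_comm]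

/-- `τᶜ ∘ τ = τ^{c+1}` (`τ = gaugeTimeShift = configShift (−e₀)`). [folklore] -/
theorem rpShift_configShift_gaugeTimeShift [MeasurableSpace G] (c : ℤ) (U : LGConfig 4 G) :
    configShift (-(Pi.single 0 c)) (gaugeTimeShift U) = configShift (-(Pi.single 0 (c + 1))) U := by
  funext e
  simp only [Literature.MathematicalPhysics.QuantumLattice.configShift_apply, gaugeTimeShift_apply,
    sub_neg_eq_add, Pi.single_add, add_assoc]

end Geometry

/-! ### Integration: bounded measurable observables, centred products -/

section Integration

variable {Ω : Type*} [MeasurableSpace Ω] {μ : Measure Ω}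

/-- A bounded measurable observable composed with a measurable map is integrable under a finite
measure. [folklore] -/
theorem rpShift_integrable_comp [IsFiniteMeasure μ] {X : Type*} [MeasurableSpace X] {H : X → ℝ}
    (hH : Measurable H) {C : ℝ} (hC : ∀ x, |H x| ≤ C) {φ : Ω → X} (hφ : Measurable φ) :
    Integrable (fun ω => H (φ ω)) μ :=
  Integrable.of_bound (hH.comp hφ).aestronglyMeasurable C
    (Eventually.of_forall fun ω => by rw [Real.norm_eq_abs]; exact hC (φ ω))

/-- The product of two bounded measurable real functions is integrable under a finite measure.
[folklore] -/
theorem rpShift_integrable_mul [IsFiniteMeasure μ] {f g : Ω → ℝ} (hf : Measurable f)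
    (hg : Measurable g) {Cf Cg : ℝ} (hCf : ∀ ω, |f ω| ≤ Cf) (hCg : ∀ ω, |g ω| ≤ Cg) :
    Integrable (fun ω => f ω * g ω) μ :=
  Integrable.of_bound (hf.mul hg).aestronglyMeasurable (Cf * Cg)
    (Eventually.of_forall fun ω => by
      rw [Real.norm_eq_abs, abs_mul]
      exact mul_le_mul (hCf ω) (hCg ω) (abs_nonneg _) ((abs_nonneg _).trans (hCf ω)))

/-- Expansion of a centred product under a probability measure:
`∫ (f − m_f)(g − m_g) = ∫ f g − m_f ∫ g − m_g ∫ f + m_f m_g`. [folklore] -/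
theorem rpShift_integral_centred_mul [IsProbabilityMeasure μ] {f g : Ω → ℝ} (hf : Integrable f μ)
    (hg : Integrable g μ) (hfg : Integrable (fun ω => f ω * g ω) μ) (mf mg : ℝ) :
    ∫ ω, (f ω - mf) * (g ω - mg) ∂μ =
      (∫ ω, f ω * g ω ∂μ) - mf * (∫ ω, g ω ∂μ) - mg * (∫ ω, f ω ∂μ) + mf * mg := by
  have h : ∀ ω, (f ω - mf) * (g ω - mg) = (f ω * g ω - mf * g ω) - (mg * f ω - mf * mg) := by
    intro ω; ring
  simp_rw [h]
  have h1 : Integrable (fun ω => f ω * g ω - mf * g ω) μ := hfg.sub (hg.const_mul mf)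
  have h2 : Integrable (fun ω => mg * f ω - mf * mg) μ := (hf.const_mul mg).sub (integrable_const _)
  rw [integral_sub h1 h2, integral_sub hfg (hg.const_mul mf),
    integral_sub (hf.const_mul mg) (integrable_const _), integral_const_mul, integral_const_mul,
    integral_const]
  simp only [probReal_univ, one_smul]
  ring

end Integration

/-! ### Invariance of the torus Wilson state transported along the periodic lift -/

section Torus

variable {G : Type} [Group G] [TopologicalSpace G] [IsTopologicalGroup G] [CompactSpace G]
  [MeasurableSpace G] [BorelSpace G] {N : ℕ} (ρ : G →* Matrix (Fin N) (Fin N) ℂ)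

/-- **Translation invariance along the lift**: `∫ H(θ_v Ũ) dμ = ∫ H(Ũ) dμ` for every `v ∈ ℤ⁴`
(`configShift_torusLift` + `wilsonExpectation_comp_torusConfigShift`). [folklore] -/
theorem rpShift_integral_configShift_torusLift (β : ℝ) (L : ℕ) [NeZero L]
    (v : Literature.Probability.LatticeModels.Site 4) (H : LGConfig 4 G → ℝ) :
    ∫ U, H (configShift v (torusLift L U)) ∂(wilsonMeasure (d := 4) (L := L) ρ β) =
      ∫ U, H (torusLift L U) ∂(wilsonMeasure (d := 4) (L := L) ρ β) := by
  simp_rw [configShift_torusLift]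
  have h := wilsonExpectation_comp_torusConfigShift (d := 4) (L := L) ρ β (Torus.proj L v)
    (H ∘ torusLift L)
  simpa only [wilsonExpectation, Function.comp_apply] using h

/-- **Reflection invariance along the lift**: `∫ H(Θ Ũ) dμ = ∫ H(Ũ) dμ`
(`gaugeTimeReflect_torusLift`, `Θ_T`-invariance and translation invariance of the torus Wilson
state). [folklore] -/
theorem rpShift_integral_gaugeTimeReflect_torusLift (hρ : Continuous ρ) (β : ℝ) (L : ℕ) [NeZero L]
    (H : LGConfig 4 G → ℝ) :
    ∫ U, H (gaugeTimeReflect (torusLift L U)) ∂(wilsonMeasure (d := 4) (L := L) ρ β) =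
      ∫ U, H (torusLift L U) ∂(wilsonMeasure (d := 4) (L := L) ρ β) := by
  simp_rw [Reconstructible.gaugeTimeReflect_torusLift]
  have h1 := Reconstructible.wilsonExpectation_comp_timeReflect (L := L) ρ hρ β
    ((H ∘ torusLift L) ∘ torusConfigShift (Pi.single 0 (-2)))
  have h2 := wilsonExpectation_comp_torusConfigShift (d := 4) (L := L) ρ β (Pi.single 0 (-2))
    (H ∘ torusLift L)
  simp only [wilsonExpectation, Function.comp_apply] at h1 h2
  rw [h1, h2]

/-- **The shift identity**: `∫ F(τᵃ Θ Ũ) G'(τᶜ Ũ) dμ = ∫ F(Θ Ũ) G'(τ^{a+c} Ũ) dμ`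
(`τᵃ Θ = Θ τ^{−a}`, then translate the torus variable by `a e₀`). [folklore] -/
theorem rpShift_integral_shift_pair (β : ℝ) (L : ℕ) [NeZero L] (F G' : LGConfig 4 G → ℝ)
    (a c : ℤ) :
    ∫ U, F (configShift (-(Pi.single 0 a)) (gaugeTimeReflect (torusLift L U))) *
        G' (configShift (-(Pi.single 0 c)) (torusLift L U)) ∂(wilsonMeasure (d := 4) (L := L) ρ β) =
      ∫ U, F (gaugeTimeReflect (torusLift L U)) *
        G' (configShift (-(Pi.single 0 (a + c))) (torusLift L U))
          ∂(wilsonMeasure (d := 4) (L := L) ρ β) := by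
  have h := rpShift_integral_configShift_torusLift ρ β L (-(Pi.single 0 a))
    (fun W => F (gaugeTimeReflect (configShift (Pi.single 0 a) W)) *
      G' (configShift (-(Pi.single 0 c)) W))
  simp only [rpShift_configShift_neg_cancel, rpShift_configShift_configShift] at h
  simp_rw [rpShift_configShift_gaugeTimeReflect]
  exact h.symm

/-- **Core of `stub_rpShift`** on a torus of arbitrary side `L ≥ 1`: for bounded measurable
`F, G'`, `a : ℕ`, `c : ℤ` and `n : ℕ` with `n = a + c`,
`corr(F∘Θ, G'; n) = ∫ (F(τᵃ Θ Ũ) − ⟨F⟩)(G'(τᶜ Ũ) − ⟨G'⟩) dμ`. [folklore] -/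
theorem rpShift_core (hρ : Continuous ρ) (β : ℝ) (L : ℕ) [NeZero L] (F G' : LGConfig 4 G → ℝ)
    (hF : Measurable F) (hG : Measurable G') (hFb : ∃ C : ℝ, ∀ U, |F U| ≤ C)
    (hGb : ∃ C : ℝ, ∀ U, |G' U| ≤ C) (a : ℕ) (c : ℤ) (n : ℕ) (hn : (n : ℤ) = a + c) :
    latticeConnectedCorr ρ β L (F ∘ gaugeTimeReflect) G' n =
      ∫ U : GaugeConfig 4 L G,
        (F (configShift (-(Pi.single 0 (a : ℤ))) (gaugeTimeReflect (torusLift L U))) -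
            ∫ V : GaugeConfig 4 L G, F (torusLift L V) ∂(wilsonMeasure ρ β)) *
          (G' (configShift (-(Pi.single 0 c)) (torusLift L U)) -
            ∫ V : GaugeConfig 4 L G, G' (torusLift L V) ∂(wilsonMeasure ρ β))
        ∂(wilsonMeasure ρ β) := by
  haveI := isProbabilityMeasure_wilsonMeasure (d := 4) (L := L) ρ hρ β
  obtain ⟨CF, hCF⟩ := hFb
  obtain ⟨CG, hCG⟩ := hGb
  have hΘ : Measurable (gaugeTimeReflect : LGConfig 4 G → LGConfig 4 G) :=
    Reconstructible.measurable_gaugeTimeReflect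
  have hlift : Measurable (torusLift (d := 4) (G := G) L) := measurable_torusLift L
  have hφ : Measurable fun U : GaugeConfig 4 L G =>
      (configShift (-(Pi.single 0 (a : ℤ))) (gaugeTimeReflect (torusLift L U)) : LGConfig 4 G) :=
    ((Literature.MathematicalPhysics.QuantumLattice.configShift _).measurable.comp hΘ).comp hlift
  have hψ : Measurable fun U : GaugeConfig 4 L G =>
      (configShift (-(Pi.single 0 c)) (torusLift L U) : LGConfig 4 G) :=
    (Literature.MathematicalPhysics.QuantumLattice.configShift _).measurable.comp hlift
  have hfi : Integrable (fun U : GaugeConfig 4 L G =>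
      F (configShift (-(Pi.single 0 (a : ℤ))) (gaugeTimeReflect (torusLift L U))))
      (wilsonMeasure ρ β) :=
    rpShift_integrable_comp hF hCF hφ
  have hgi : Integrable (fun U : GaugeConfig 4 L G =>
      G' (configShift (-(Pi.single 0 c)) (torusLift L U))) (wilsonMeasure ρ β) :=
    rpShift_integrable_comp hG hCG hψ
  have hfgi : Integrable (fun U : GaugeConfig 4 L G =>
      F (configShift (-(Pi.single 0 (a : ℤ))) (gaugeTimeReflect (torusLift L U))) *
        G' (configShift (-(Pi.single 0 c)) (torusLift L U))) (wilsonMeasure ρ β) :=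
    rpShift_integrable_mul (hF.comp hφ) (hG.comp hψ) (fun U => hCF _) (fun U => hCG _)
  have hmeanF : ∫ U, F (configShift (-(Pi.single 0 (a : ℤ))) (gaugeTimeReflect (torusLift L U)))
      ∂(wilsonMeasure ρ β) = ∫ V, F (torusLift L V) ∂(wilsonMeasure ρ β) := by
    simp_rw [rpShift_configShift_gaugeTimeReflect]
    have h := rpShift_integral_configShift_torusLift ρ β L (Pi.single 0 (a : ℤ))
      (F ∘ gaugeTimeReflect)
    simp only [Function.comp_apply] at h
    rw [h]
    exact rpShift_integral_gaugeTimeReflect_torusLift ρ hρ β L F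
  have hmeanFΘ : ∫ U, F (gaugeTimeReflect (torusLift L U)) ∂(wilsonMeasure ρ β) =
      ∫ V, F (torusLift L V) ∂(wilsonMeasure ρ β) :=
    rpShift_integral_gaugeTimeReflect_torusLift ρ hρ β L F
  have hmeanG : ∫ U, G' (configShift (-(Pi.single 0 c)) (torusLift L U)) ∂(wilsonMeasure ρ β) =
      ∫ V, G' (torusLift L V) ∂(wilsonMeasure ρ β) :=
    rpShift_integral_configShift_torusLift ρ β L _ G'
  have hpair := rpShift_integral_shift_pair ρ β L F G' a c
  unfold latticeConnectedCorr
  rw [rpShift_integral_centred_mul hfi hgi hfgi, hmeanF, hmeanG, hpair]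
  simp only [Function.comp_apply]
  rw [hmeanFΘ, hn]
  ring

end Torus

/-- `stub_rpShift` — **connected time correlations of reflected pairs are RP-form values of centred, shifted
observables** (reshape 17 glue; torus translation invariance `wilsonExpectation_comp_torusConfigShift`, `Θ_T`-invariance
`wilsonExpectation_comp_timeReflect`, the lift intertwiners and `τΘτ = Θ`): for real bounded measurable `F, G'` and
`a, b : ℕ`, on the torus of side `2S+1`,
`corr(F∘Θ, G'; a+b) = ∫ (F(τᵃ Θ Ũ) − ⟨F⟩)(G'(τᵇ Ũ) − ⟨G'⟩)` and
`corr(F∘Θ, G'; a+b+1) = ∫ (F(τᵃ Θ Ũ) − ⟨F⟩)(G'(τᵇ τ Ũ) − ⟨G'⟩)` (`τᶜ = configShift (−c e₀)`, the translation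
of `latticeConnectedCorr`; `⟨·⟩` the torus mean). No support hypothesis is needed. [folklore] -/
theorem stub_rpShift :
    ∀ (G : Type) [Group G] [TopologicalSpace G] [IsTopologicalGroup G] [CompactSpace G]
      [MeasurableSpace G] [BorelSpace G] (r : LatticeRep G),
      ∀ (β : ℝ) (S : ℕ) (F G' : LGConfig 4 G → ℝ),
      Measurable F → Measurable G' → (∃ C : ℝ, ∀ U, |F U| ≤ C) → (∃ C : ℝ, ∀ U, |G' U| ≤ C) →
      ∀ a b : ℕ,
      latticeConnectedCorr r.ρ β (2 * S + 1) (F ∘ gaugeTimeReflect) G' (a + b) =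
        ∫ U : GaugeConfig 4 (2 * S + 1) G,
          (F (configShift (-(Pi.single 0 (a : ℤ))) (gaugeTimeReflect (torusLift (2 * S + 1) U))) -
              ∫ V : GaugeConfig 4 (2 * S + 1) G, F (torusLift (2 * S + 1) V) ∂(wilsonMeasure r.ρ β)) *
            (G' (configShift (-(Pi.single 0 (b : ℤ))) (torusLift (2 * S + 1) U)) -
              ∫ V : GaugeConfig 4 (2 * S + 1) G, G' (torusLift (2 * S + 1) V) ∂(wilsonMeasure r.ρ β))
          ∂(wilsonMeasure r.ρ β) ∧
      latticeConnectedCorr r.ρ β (2 * S + 1) (F ∘ gaugeTimeReflect) G' (a + b + 1) =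
        ∫ U : GaugeConfig 4 (2 * S + 1) G,
          (F (configShift (-(Pi.single 0 (a : ℤ))) (gaugeTimeReflect (torusLift (2 * S + 1) U))) -
              ∫ V : GaugeConfig 4 (2 * S + 1) G, F (torusLift (2 * S + 1) V) ∂(wilsonMeasure r.ρ β)) *
            (G' (configShift (-(Pi.single 0 (b : ℤ))) (gaugeTimeShift (torusLift (2 * S + 1) U))) -
              ∫ V : GaugeConfig 4 (2 * S + 1) G, G' (torusLift (2 * S + 1) V) ∂(wilsonMeasure r.ρ β))
          ∂(wilsonMeasure r.ρ β) := by
  intro G _ _ _ _ _ _ r β S F G' hF hG hFb hGb a b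
  refine ⟨rpShift_core r.ρ r.continuous β (2 * S + 1) F G' hF hG hFb hGb a (b : ℤ) (a + b)
    (Nat.cast_add a b), ?_⟩
  have h := rpShift_core r.ρ r.continuous β (2 * S + 1) F G' hF hG hFb hGb a ((b : ℤ) + 1)
    (a + b + 1) (by push_cast; ring)
  simp_rw [rpShift_configShift_gaugeTimeShift]
  exact h

end Summit.QuantumFields.YangMills.Theorems.ContinuumLegGivenGap

end
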